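import Literature.AlgebraicGeometry.Limits.LocalizationSmoothSpread
import Literature.AlgebraicGeometry.Limits.LocalizationOpenDescent
import Mathlib.AlgebraicGeometry.Morphisms.Etale
import HarnessLib

/-!
# Étaleness (smoothness of relative dimension `n`) of a morphism spreads out from `Spec A_S` to a stage `Spec A[1/s]`

Topic: `Literature/AlgebraicGeometry/Limits`; sequel of `Limits/LocalizationSmoothSpread` (which
treats the *structure morphism* `P → Spec A`) for a *morphism* `f : Q → P` of `A`-schemes
(`A` a commutative ring, `S ⊆ A` a submonoid, `B = A_S`, `Spec B = lim_s Spec A[1/s]`,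
`LocApprox.Idx S`). For `T` an `A`-algebra write `f_T = (f ▷ Spec T).left : Q ×_A Spec T → P ×_A Spec T`
for the base change.

* `exists_opens_smoothOfRelativeDimension_ι_comp` — for `g : X → Y` locally of finite
  presentation there is an open `W ⊆ X` on which `g` is smooth of relative dimension `n` and which
  contains the image of `X ×_Y Y'` for every flat `Y' → Y` surjective on stalks over which the base
  change of `g` is smooth of relative dimension `n` (the union of all good opens;
  `Literature.AlgebraicGeometry.Motives.exists_smoothOfRelativeDimension_ι_comp_of_isPullback` of `Motives/SmoothSpread`).
* `LocApprox.exists_forall_smoothOfRelativeDimension_whiskerRight` — **if `f_B` is smooth of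
  relative dimension `n` then so is `f_T` for every model `T` of `A[1/t]`, `t` any multiple of
  some `s ∈ S`** (`Q` quasi-compact over `A`, `f` locally of finite presentation): the preimage of
  `W` in the limit `Q ×_A Spec B = lim_s Q ×_A Spec A[1/s]` is everything, hence so is its preimage
  in some stage (Mathlib `exists_map_eq_top`), and `f_T` is the base change of `W → P` as soon as
  `Q ×_A Spec T → Q` lands in `W`.
* `LocApprox.exists_forall_etale_whiskerRight` — the case `n = 0`: **étaleness spreads out from
  the localization `A_S` (e.g. the generic point of a domain) to a basic open neighbourhood**
  (EGA IV₄ 17.7.8 (ii); The Stacks Project, Tag 07RP, for the system of basic opens `D(s)`).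

Everything is proved; no definitions, no named facts.

## References

* A. Grothendieck, EGA IV₄, Publ. Math. IHÉS 32 (1967), Prop. 17.7.8 (ii). [EGAIV4]
* The Stacks Project, Tags 0C0C, 0EY2 (smoothness and relative dimension descend through
  limits), 07RP (étale), 01ZC. [StacksProject]
-/

noncomputable section

universe u

open CategoryTheory CategoryTheory.Limits AlgebraicGeometry TopologicalSpace MonoidalCategory
open Opposite

namespace Literature.AlgebraicGeometry.Limits

open Literature.AlgebraicGeometry.Motives (SchemeOver specOver
  smoothOfRelativeDimension_sSup_ι_comp smoothOfRelativeDimension_of_range_subset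
  exists_smoothOfRelativeDimension_ι_comp_of_isPullback)

set_option backward.isDefEq.respectTransparency false

/-! ## The locus where a morphism is smooth of relative dimension `n` -/

/-- **The good locus.** For `g : X → Y` locally of finite presentation there is an open `W ⊆ X`
with `W → Y` smooth of relative dimension `n`, containing the image of `pr : X' → X` for every
cartesian square `(pr, g'; g, i)` with `i : Y' → Y` flat and surjective on stalks and `g'` smooth
of relative dimension `n` (take the union of all opens on which `g` is smooth of relative
dimension `n`; Stacks 0C0C/0EY2, pointwise form, `Motives/SmoothSpread`).
[cite: StacksProject, Tags 0C0C and 0EY2] -/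
theorem exists_opens_smoothOfRelativeDimension_ι_comp {X Y : Scheme.{u}} (n : ℕ) (g : X ⟶ Y)
    [LocallyOfFinitePresentation g] :
    ∃ W : X.Opens, SmoothOfRelativeDimension n (W.ι ≫ g) ∧
      ∀ ⦃X' Y' : Scheme.{u}⦄ (g' : X' ⟶ Y') (pr : X' ⟶ X) (i : Y' ⟶ Y), IsPullback pr g' g i →
        Flat i → SurjectiveOnStalks i → SmoothOfRelativeDimension n g' →
          Set.range pr ⊆ (W : Set X) := by
  refine ⟨sSup {V : X.Opens | SmoothOfRelativeDimension n (V.ι ≫ g)},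
    smoothOfRelativeDimension_sSup_ι_comp n g _ (fun _ hV ↦ hV), ?_⟩
  intro X' Y' g' pr i H _ _ _
  rintro _ ⟨x', rfl⟩
  have h : g (pr x') = i (g' x') := by
    rw [← Scheme.Hom.comp_apply, H.w, Scheme.Hom.comp_apply]
  obtain ⟨V, hV, hxV⟩ := exists_smoothOfRelativeDimension_ι_comp_of_isPullback n H (pr x') (g' x') h
  exact (le_sSup (s := {V : X.Opens | SmoothOfRelativeDimension n (V.ι ≫ g)}) hV : V ≤ _) hxV

namespace LocApprox

section Limit

variable {A : Type u} [CommRing A] (S : Submonoid A) (B : Type u) [CommRing B] [Algebra A B]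
  [IsLocalization S B] {Q P : SchemeOver A} (f : Q ⟶ P)

/-- **Stage form.** Let `f : Q → P` be a morphism of `A`-schemes, `Q` quasi-compact over `A` and
`f` locally of finite presentation, whose base change `f_B` to `B = A_S` is smooth of relative
dimension `n`. Then there are an open `W ⊆ Q` with `W → P` smooth of relative dimension `n` and a
stage `s ∈ S` such that the open subscheme `Q ×_A Spec A[1/s]` of `Q` lies in `W`: the base change
`Q ×_A Spec B → P ×_A Spec B` is cartesian over `f` along the flat, surjective-on-stalks
`P ×_A Spec B → P`, so `Q ×_A Spec B → Q` lands in the good locus `W`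
(`exists_opens_smoothOfRelativeDimension_ι_comp`); its preimage in the limit
`Q ×_A Spec B = lim_s Q ×_A Spec A[1/s]` being everything, so is its preimage in some stage
(Mathlib `exists_map_eq_top`). [cite: StacksProject, Tag 0C0C] -/
theorem exists_range_fst_subset_of_smoothOfRelativeDimension [QuasiCompact Q.hom]
    [LocallyOfFinitePresentation f.left] (n : ℕ)
    [SmoothOfRelativeDimension n (f ▷ specOver A B).left] :
    ∃ (W : Q.left.Opens) (s : Idx S), SmoothOfRelativeDimension n (W.ι ≫ f.left) ∧
      Set.range (pullback.fst Q.hom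
        (Spec.map (CommRingCat.ofHom (algebraMap A (loc S s))))) ⊆ (W : Set Q.left) := by
  obtain ⟨W, hW, hsub⟩ := exists_opens_smoothOfRelativeDimension_ι_comp n f.left
  -- the base change to `B` lands in `W`
  haveI : Flat (specOver A B).hom := flat_specMap_algebraMap S B
  haveI : SurjectiveOnStalks (specOver A B).hom := surjectiveOnStalks_specMap_algebraMap S B
  haveI : Flat (pullback.fst P.hom (specOver A B).hom) :=
    MorphismProperty.pullback_fst _ _ inferInstance
  haveI : SurjectiveOnStalks (pullback.fst P.hom (specOver A B).hom) :=
    MorphismProperty.pullback_fst _ _ inferInstance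
  have hB : Set.range (pullback.fst Q.hom (specOver A B).hom) ⊆ (W : Set Q.left) :=
    hsub _ _ _ (isPullback_whiskerRight_left f (specOver A B)).flip inferInstance inferInstance
      inferInstance
  -- the open `W|` of the stage `1`, whose preimage in the limit is everything
  let U : ((prodDiagram S Q).obj default).Opens :=
    (pullback.fst Q.hom (Spec.map (CommRingCat.ofHom (algebraMap A (loc S default))))) ⁻¹ᵁ W
  have hU : (prodCone S B Q).π.app default ⁻¹ᵁ U = ⊤ := by
    change ((prodCone S B Q).π.app default ≫ pullback.fst _ _) ⁻¹ᵁ W = ⊤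
    rw [prodCone_π_app_fst, preimage_eq_top_iff_range_subset]
    exact hB
  obtain ⟨t, fts, ht⟩ :=
    exists_map_eq_top (prodDiagram S Q) (prodCone S B Q) (isLimitProdCone S B Q) U hU
  refine ⟨W, t, hW, ?_⟩
  rw [← preimage_eq_top_iff_range_subset]
  change (pullback.fst Q.hom ((baseDiagram S).obj t).hom) ⁻¹ᵁ W = ⊤
  rw [← prodDiagram_map_fst S Q fts]
  exact ht

/-- **Smoothness of relative dimension `n` of a morphism descends through
`Spec A_S = lim Spec A[1/s]`** (Stacks 0C0C, 0EY2; EGA IV₄ 17.7.8 (ii), for the cofiltered system of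
basic opens `D(s)`, `s ∈ S`). Let `f : Q → P` be a morphism of `A`-schemes, `Q` quasi-compact over
`A`, `f` locally of finite presentation, with `f_B : Q ×_A Spec B → P ×_A Spec B` smooth of relative
dimension `n`, `B = A_S`. Then there is `s ∈ S` such that for every multiple `t` of `s` and every
model `T` of `A[1/t]`, the base change `f_T` is smooth of relative dimension `n`.
[cite: StacksProject, Tags 0C0C and 0EY2] [cite: EGAIV4, Prop. 17.7.8 (ii)] -/
theorem exists_forall_smoothOfRelativeDimension_whiskerRight [QuasiCompact Q.hom]
    [LocallyOfFinitePresentation f.left] (n : ℕ)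
    [SmoothOfRelativeDimension n (f ▷ specOver A B).left] :
    ∃ s ∈ S, ∀ t : A, s ∣ t → ∀ (T : Type u) [CommRing T] [Algebra A T] [IsLocalization.Away t T],
      SmoothOfRelativeDimension n (f ▷ specOver A T).left := by
  obtain ⟨W, s, hW, hs⟩ := exists_range_fst_subset_of_smoothOfRelativeDimension S B f n
  refine ⟨s.val, s.mem, fun t hst T _ _ _ => ?_⟩
  have hle : (PrimeSpectrum.basicOpen t : Set (PrimeSpectrum A)) ⊆ PrimeSpectrum.basicOpen s.val := by
    obtain ⟨c, rfl⟩ := hst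
    exact PrimeSpectrum.basicOpen_mul_le_left s.val c
  have hrange : Set.range (pullback.fst Q.hom (specOver A T).hom) ⊆ (W : Set Q.left) := by
    change Set.range (pullback.fst Q.hom (Spec.map (CommRingCat.ofHom (algebraMap A T)))) ⊆ _
    rw [range_fst_eq_preimage_basicOpen Q T t]
    refine subset_trans (Set.preimage_mono hle) ?_
    rw [← range_fst_eq_preimage_basicOpen Q (loc S s) s.val]
    exact hs
  exact smoothOfRelativeDimension_of_range_subset hW
    (isPullback_whiskerRight_left f (specOver A T)).flip hrange

/-- **Étaleness descends through `Spec A_S = lim Spec A[1/s]`** (EGA IV₄ 17.7.8 (ii); Stacks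
07RP with 01ZC): if `f_B` is étale (`Q` quasi-compact over `A`, `f` locally of finite
presentation, `B = A_S`) then `f_T` is étale for every model `T` of `A[1/t]`, `t` any multiple of
some `s ∈ S`. With `A` a domain and `B = Frac A`: a morphism whose generic fibre is étale is étale
over a dense open subset of `Spec A`. [cite: EGAIV4, Prop. 17.7.8 (ii)]
[cite: StacksProject, Tag 07RP] -/
theorem exists_forall_etale_whiskerRight [QuasiCompact Q.hom] [LocallyOfFinitePresentation f.left]
    [Etale (f ▷ specOver A B).left] :
    ∃ s ∈ S, ∀ t : A, s ∣ t → ∀ (T : Type u) [CommRing T] [Algebra A T] [IsLocalization.Away t T],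
      Etale (f ▷ specOver A T).left := by
  obtain ⟨s, hs, h⟩ := exists_forall_smoothOfRelativeDimension_whiskerRight S B f 0
  refine ⟨s, hs, fun t hst T _ _ _ => ?_⟩
  haveI := h t hst T
  exact (Etale.iff_smoothOfRelativeDimension_zero ((f ▷ specOver A T).left)).mpr inferInstance

end Limit

end LocApprox

end Literature.AlgebraicGeometry.Limits

end
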